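import Literature.Barriers.CriticalPhenomena.PlanarEdwardsModelDiffusiveProofs
import Mathlib.Analysis.SpecialFunctions.Trigonometric.Basic
import Mathlib.Analysis.SpecialFunctions.Trigonometric.Bounds
import Mathlib.Analysis.SpecialFunctions.Log.Deriv
import Mathlib.Analysis.SpecialFunctions.Complex.LogBounds
import Mathlib.Topology.Algebra.Order.Floor
import HarnessLib

/-!
# Finite-dimensional distributions of the rescaled planar walk: the characteristic function
# of a linear statistic of the steps (towards Donsker, half (D-b))

Sibling proof file of `Literature.Barriers.CriticalPhenomena.PlanarEdwardsModelDiffusive`. On the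
finite probability space of `n`-step walks (uniform on `StepSeq n = Fin n → Fin 4`) the steps are
independent, so the uniform average of a product of functions of the single steps factorises
(`expect_prod_steps`), the characteristic function of a linear statistic `Σ_k u_k · e_{ω_k}`
of the steps is the explicit product `Π_k (cos u_k⁰ + cos u_k¹)/2` (`expect_exp_sum_steps`),
and by Abel summation (`sum_mul_pos_eq_sum_mul_stepVec`) so is the characteristic function of
any linear statistic of finitely many positions `ω(m_i)` (`expect_exp_sum_pos`) —
the starting point of the multidimensional central limit theorem for the increments of the walk
(core (D-b) of `Edwards2D.Stoll1989_invariance_of_fdd_of_mollify`); and the Gaussian limit of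
these products (`tendsto_prod_half_cos_add_cos`: for bounded coefficients `w_{n,k}` with
`(1/n) Σ_{k<n} |w_{n,k}|² → σ²`, `Π_{k<n} (cos(√(2/n) w⁰) + cos(√(2/n) w¹))/2 → e^{-σ²/2}`, via
`tendsto_prod_one_sub` — products of factors `1 - x_{n,k}` with `Σ x → S`, `Σ x² → 0` — and the
bounds `cos_bound`, `abs_log_sub_add_sum_range_le`), together with the Riemann-sum limit
`⌊nc⌋/n → c`; finally the covariance Riemann sum (`sum_sq_coeff_eq`, `tendsto_sum_sq_coeff`:
`(1/n) Σ_{k<n} |w_{n,k}|² → σ² = Σ_{i,i'} (v_i·v_{i'}) min(t_i, t_{i'})` for `w_{n,k} = Σ_{i : k < ⌊nt_i⌋} v_i`)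
and the **random-walk half of the convergence of the finite-dimensional distributions**,
`tendsto_expect_exp_scaled_pos`: `𝔼 exp(i √(2/n) Σ_i v_i · ω(⌊n t_i⌋)) → e^{-σ²/2}`.

## References

* P. Billingsley, *Convergence of Probability Measures*, 2nd ed. (1999), proof of Theorem 8.2.
* G. F. Lawler, *Intersections of Random Walks* (1991), §1.2 (characteristic function of the
  simple random walk, `φ(θ) = (1/d) Σ cos θ_j`).
-/

noncomputable section

open Finset Filter Topology
open scoped BigOperators

namespace Literature.Barriers.CriticalPhenomena

namespace Edwards2D

open Literature.Probability.LatticeModels Literature.Probability.Percolation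

variable {n : ℕ}

/-- **Independence of the steps**: the uniform average over `n`-step walks of a product of
functions of the single steps is the product of the one-step averages. [cite: Lawler1991, §1.2] -/
theorem expect_prod_steps (f : Fin n → Fin 4 → ℂ) :
    𝔼 ω : StepSeq n, ∏ k, f k (ω k) = ∏ k, 𝔼 a : Fin 4, f k a := by
  simp_rw [Finset.expect_eq_sum_div_card, Finset.card_univ, Fintype.card_fin]
  rw [Finset.prod_div_distrib, Finset.prod_const, Finset.card_univ, Fintype.card_fin,
    Fintype.card_fun, Fintype.card_fin, Fintype.card_fin]
  congr 1
  · rw [Finset.prod_univ_sum]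
    simp [Fintype.piFinset_univ]
  · push_cast; ring

/-- The one-step characteristic function of the planar simple random walk:
`¼ Σ_a e^{i u·e_a} = (cos u₀ + cos u₁)/2`. [cite: Lawler1991, §1.2 (φ(θ) = d⁻¹ Σ cos θ_j)] -/
theorem expect_exp_step (u : Fin 2 → ℝ) :
    𝔼 a : Fin 4, Complex.exp (Complex.I * ((∑ j, u j * (stepVec a j : ℝ) : ℝ) : ℂ)) =
      (((Real.cos (u 0) + Real.cos (u 1)) / 2 : ℝ) : ℂ) := by
  rw [Finset.expect_eq_sum_div_card, Finset.card_univ, Fintype.card_fin, Fin.sum_univ_four]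
  simp only [Fin.sum_univ_two, stepVec_zero, stepVec_one, stepVec_two, stepVec_three,
    Pi.single_apply, Pi.neg_apply]
  simp only [OfNat.ofNat_ne_one, if_true, if_false, one_ne_zero,
    Fin.zero_eq_one_iff, Int.cast_one, Int.cast_zero, Int.cast_neg, mul_one, mul_zero, mul_neg,
    add_zero, zero_add, neg_zero]
  -- `e^{iu} + e^{-iu} = 2 cos u`
  have hcos : ∀ x : ℝ, Complex.exp (Complex.I * (x : ℂ)) + Complex.exp (Complex.I * ((-x : ℝ) : ℂ)) =
      ((2 * Real.cos x : ℝ) : ℂ) := by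
    intro x
    rw [show Complex.I * (x : ℂ) = (x : ℂ) * Complex.I by ring,
      show Complex.I * ((-x : ℝ) : ℂ) = -(x : ℂ) * Complex.I by push_cast; ring,
      ← Complex.ofReal_neg, Complex.exp_mul_I, Complex.exp_mul_I]
    push_cast
    rw [Complex.cos_neg, Complex.sin_neg, ← Complex.ofReal_cos, ← Complex.ofReal_sin]
    push_cast; ring
  have h0 := hcos (u 0)
  have h1 := hcos (u 1)
  push_cast at h0 h1 ⊢
  linear_combination (h0 + h1) / 4

/-- **Characteristic function of a linear statistic of the steps**: for coefficient vectors
`u_k ∈ ℝ²`, `𝔼 exp(i Σ_k u_k · e_{ω_k}) = Π_k (cos u_k⁰ + cos u_k¹)/2` exactly (independence of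
the steps and the one-step formula). [cite: Lawler1991, §1.2] -/
theorem expect_exp_sum_steps (u : Fin n → Fin 2 → ℝ) :
    𝔼 ω : StepSeq n, Complex.exp (Complex.I *
        ((∑ k, ∑ j, u k j * (stepVec (ω k) j : ℝ) : ℝ) : ℂ)) =
      ∏ k, (((Real.cos (u k 0) + Real.cos (u k 1)) / 2 : ℝ) : ℂ) := by
  have : ∀ ω : StepSeq n, Complex.exp (Complex.I * ((∑ k, ∑ j, u k j * (stepVec (ω k) j : ℝ) : ℝ) : ℂ)) =
      ∏ k, Complex.exp (Complex.I * ((∑ j, u k j * (stepVec (ω k) j : ℝ) : ℝ) : ℂ)) := by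
    intro ω
    rw [← Complex.exp_sum]
    congr 1
    push_cast
    rw [Finset.mul_sum]
  simp_rw [this]
  rw [expect_prod_steps (f := fun k a => Complex.exp (Complex.I * ((∑ j, u k j * (stepVec a j : ℝ) : ℝ) : ℂ)))]
  exact Finset.prod_congr rfl fun k _ => expect_exp_step (u k)


/-- **Abel summation**: a linear statistic of finitely many positions `ω(m_i)` (`m_i ≤ n`) is a
linear statistic of the steps, with coefficient `Σ_{i : k < m_i} v_i` on the `k`-th step.
[folklore] -/
theorem sum_mul_pos_eq_sum_mul_stepVec {ι : Type*} (s : Finset ι) (v : ι → Fin 2 → ℝ) (m : ι → ℕ)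
    (ω : StepSeq n) :
    ∑ i ∈ s, ∑ j, v i j * (pos ω (m i) j : ℝ) =
      ∑ k : Fin n, ∑ j, (∑ i ∈ s with (k : ℕ) < m i, v i j) * (stepVec (ω k) j : ℝ) := by
  -- both sides equal the triple sum of `F i j k = 𝟙{k < m_i} v_i^j e_{ω_k}^j`
  set F : ι → Fin 2 → Fin n → ℝ := fun i j k =>
    if (k : ℕ) < m i then v i j * (stepVec (ω k) j : ℝ) else 0 with hF
  have hL : ∀ (i : ι) (j : Fin 2), v i j * (pos ω (m i) j : ℝ) = ∑ k : Fin n, F i j k := by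
    intro i j
    unfold pos
    rw [Finset.sum_apply]
    push_cast
    rw [Finset.mul_sum]
    refine Finset.sum_congr rfl fun k _ => ?_
    simp only [hF]
    split_ifs <;> simp
  have hR : ∀ (k : Fin n) (j : Fin 2),
      (∑ i ∈ s with (k : ℕ) < m i, v i j) * (stepVec (ω k) j : ℝ) = ∑ i ∈ s, F i j k := by
    intro k j
    rw [Finset.sum_filter, Finset.sum_mul]
    refine Finset.sum_congr rfl fun i _ => ?_
    simp only [hF]
    split_ifs <;> simp
  simp_rw [hL, hR]
  calc ∑ i ∈ s, ∑ j : Fin 2, ∑ k : Fin n, F i j k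
      = ∑ i ∈ s, ∑ k : Fin n, ∑ j : Fin 2, F i j k :=
        Finset.sum_congr rfl fun i _ => Finset.sum_comm
    _ = ∑ k : Fin n, ∑ i ∈ s, ∑ j : Fin 2, F i j k := Finset.sum_comm
    _ = ∑ k : Fin n, ∑ j : Fin 2, ∑ i ∈ s, F i j k :=
        Finset.sum_congr rfl fun k _ => Finset.sum_comm

/-- **Characteristic function of the finite-dimensional distributions of the walk**: for times
`m_i` and dual vectors `v_i ∈ ℝ²`,
`𝔼 exp(i Σ_i v_i · ω(m_i)) = Π_{k<n} (cos c_k⁰ + cos c_k¹)/2`, `c_k = Σ_{i : k < m_i} v_i` — an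
exact formula on the `4ⁿ` walks (Abel summation + independence of the steps).
[cite: Lawler1991, §1.2] [cite: Billingsley1999, proof of Theorem 8.2] -/
theorem expect_exp_sum_pos {ι : Type*} (s : Finset ι) (v : ι → Fin 2 → ℝ) (m : ι → ℕ) :
    𝔼 ω : StepSeq n, Complex.exp (Complex.I *
        ((∑ i ∈ s, ∑ j, v i j * (pos ω (m i) j : ℝ) : ℝ) : ℂ)) =
      ∏ k : Fin n, (((Real.cos (∑ i ∈ s with (k : ℕ) < m i, v i 0) +
        Real.cos (∑ i ∈ s with (k : ℕ) < m i, v i 1)) / 2 : ℝ) : ℂ) := by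
  simp_rw [sum_mul_pos_eq_sum_mul_stepVec s v m]
  exact expect_exp_sum_steps (fun k j => ∑ i ∈ s with (k : ℕ) < m i, v i j)

/-! ### Products of factors close to `1` -/

/-- **Products of factors close to one**: if `0 ≤ x_{n,k} ≤ 1/2` eventually, `Σ_{k<n} x_{n,k} → S`
and `Σ_{k<n} x_{n,k}² → 0`, then `Π_{k<n} (1 - x_{n,k}) → e^{-S}`. [folklore] -/
theorem tendsto_prod_one_sub {x : ℕ → ℕ → ℝ} {S : ℝ}
    (hx : ∀ᶠ n in atTop, ∀ k < n, 0 ≤ x n k ∧ x n k ≤ 1 / 2)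
    (hsum : Tendsto (fun n => ∑ k ∈ range n, x n k) atTop (𝓝 S))
    (hsq : Tendsto (fun n => ∑ k ∈ range n, x n k ^ 2) atTop (𝓝 0)) :
    Tendsto (fun n => ∏ k ∈ range n, (1 - x n k)) atTop (𝓝 (Real.exp (-S))) := by
  -- `|log(1 - y) + y| ≤ 2y²` for `0 ≤ y ≤ 1/2` (Mathlib's `abs_log_sub_add_sum_range_le`)
  have abs_log_one_sub_add_le : ∀ {y : ℝ}, 0 ≤ y → y ≤ 1 / 2 →
      |Real.log (1 - y) + y| ≤ 2 * y ^ 2 := by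
    intro y hy0 hy
    have hy1 : |y| < 1 := by rw [abs_of_nonneg hy0]; linarith
    have h := Real.abs_log_sub_add_sum_range_le hy1 1
    have h' : |Real.log (1 - y) + y| ≤ y ^ 2 / (1 - y) := by
      simpa [abs_of_nonneg hy0, add_comm] using h
    refine h'.trans ?_
    rw [div_le_iff₀ (by linarith)]
    nlinarith [sq_nonneg y]
  -- the logarithm of the product
  have hlog : Tendsto (fun n => ∑ k ∈ range n, Real.log (1 - x n k)) atTop (𝓝 (-S)) := by
    have h1 : Tendsto (fun n => -∑ k ∈ range n, x n k) atTop (𝓝 (-S)) := hsum.neg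
    have h2 : Tendsto (fun n => ∑ k ∈ range n, Real.log (1 - x n k) - -∑ k ∈ range n, x n k)
        atTop (𝓝 0) := by
      rw [tendsto_zero_iff_abs_tendsto_zero]
      refine squeeze_zero' (Eventually.of_forall fun n => abs_nonneg _) ?_
        (by simpa using hsq.const_mul 2)
      filter_upwards [hx] with n hn
      simp only [Function.comp_apply]
      rw [sub_neg_eq_add, ← Finset.sum_add_distrib, Finset.mul_sum]
      refine (Finset.abs_sum_le_sum_abs _ _).trans (Finset.sum_le_sum fun k hk => ?_)
      exact abs_log_one_sub_add_le (hn k (mem_range.1 hk)).1 (hn k (mem_range.1 hk)).2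
    simpa using h2.add h1
  have hexp := (Real.continuous_exp.tendsto _).comp hlog
  refine hexp.congr' ?_
  filter_upwards [hx] with n hn
  simp only [Function.comp_apply]
  rw [Real.exp_sum]
  exact Finset.prod_congr rfl fun k hk => Real.exp_log (by linarith [(hn k (mem_range.1 hk)).2])

/-! ### The one-step factor `(cos a₀ + cos a₁)/2` -/

/-- `(cos a₀ + cos a₁)/2 = 1 - x` with `0 ≤ x` and `|x - (a₀² + a₁²)/4| ≤ (5/96)(a₀⁴ + a₁⁴)/2`
for `|a₀|, |a₁| ≤ 1`. [folklore] -/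
theorem half_cos_add_cos_bound {a₀ a₁ : ℝ} (h0 : |a₀| ≤ 1) (h1 : |a₁| ≤ 1) :
    |(1 - (Real.cos a₀ + Real.cos a₁) / 2) - (a₀ ^ 2 + a₁ ^ 2) / 4| ≤
      5 / 96 * (a₀ ^ 4 + a₁ ^ 4) / 2 := by
  have e0 := Real.cos_bound h0
  have e1 := Real.cos_bound h1
  rw [abs_le] at e0 e1 ⊢
  have p0 : |a₀| ^ 4 = a₀ ^ 4 := by rw [← abs_pow, abs_of_nonneg (by positivity)]
  have p1 : |a₁| ^ 4 = a₁ ^ 4 := by rw [← abs_pow, abs_of_nonneg (by positivity)]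
  rw [p0] at e0; rw [p1] at e1
  constructor <;> linarith [e0.1, e0.2, e1.1, e1.2]

/-- `0 ≤ 1 - (cos a₀ + cos a₁)/2`. [folklore] -/
theorem one_sub_half_cos_add_cos_nonneg (a₀ a₁ : ℝ) : 0 ≤ 1 - (Real.cos a₀ + Real.cos a₁) / 2 := by
  linarith [Real.cos_le_one a₀, Real.cos_le_one a₁]

/-- `1 - (cos a₀ + cos a₁)/2 ≤ (a₀² + a₁²)/4`. [folklore] -/
theorem one_sub_half_cos_add_cos_le (a₀ a₁ : ℝ) :
    1 - (Real.cos a₀ + Real.cos a₁) / 2 ≤ (a₀ ^ 2 + a₁ ^ 2) / 4 := by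
  linarith [Real.one_sub_sq_div_two_le_cos (x := a₀), Real.one_sub_sq_div_two_le_cos (x := a₁)]

/-! ### Riemann sums of the step coefficients -/

/-- `⌊n c⌋ / n → c` for `c ≥ 0`. [folklore] -/
theorem tendsto_floor_mul_div {c : ℝ} (hc : 0 ≤ c) :
    Tendsto (fun n : ℕ => (⌊(n : ℝ) * c⌋₊ : ℝ) / n) atTop (𝓝 c) := by
  have h1 : Tendsto (fun n : ℕ => ((n : ℝ) * c - 1) / n) atTop (𝓝 c) := by
    have h0 : Tendsto (fun n : ℕ => c - 1 / (n : ℝ)) atTop (𝓝 c) := by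
      have := (tendsto_const_nhds (x := c) (f := (atTop : Filter ℕ))).sub
        tendsto_one_div_atTop_nhds_zero_nat
      rwa [sub_zero] at this
    refine (tendsto_congr' ?_).1 h0
    filter_upwards [eventually_gt_atTop 0] with n hn
    field_simp
  have h2 : Tendsto (fun n : ℕ => ((n : ℝ) * c) / n) atTop (𝓝 c) := by
    refine (tendsto_congr' ?_).1 tendsto_const_nhds
    filter_upwards [eventually_gt_atTop 0] with n hn
    field_simp
  refine tendsto_of_tendsto_of_tendsto_of_le_of_le' h1 h2 ?_ ?_
  · filter_upwards [eventually_gt_atTop 0] with n hn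
    exact div_le_div_of_nonneg_right (Nat.sub_one_lt_floor _).le (by positivity)
  · filter_upwards [eventually_gt_atTop 0] with n hn
    exact div_le_div_of_nonneg_right (Nat.floor_le (by positivity)) (by positivity)


/-! ### The limit of the product of one-step factors -/

/-- **Gaussian limit of the characteristic function of the walk's finite-dimensional
statistics**: for coefficient vectors `w_{n,k} ∈ ℝ²` bounded by `M` with
`(1/n) Σ_{k<n} |w_{n,k}|² → σ²`, the exact characteristic function
`Π_{k<n} (cos(√(2/n) w⁰_{n,k}) + cos(√(2/n) w¹_{n,k}))/2` of `expect_exp_sum_pos` tends to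
`exp(-σ²/2)`. [cite: Billingsley1999, proof of Theorem 8.2] -/
theorem tendsto_prod_half_cos_add_cos {w : ℕ → ℕ → Fin 2 → ℝ} {M σ2 : ℝ}
    (hM : ∀ n k j, |w n k j| ≤ M)
    (hlim : Tendsto (fun n : ℕ => (1 / (n : ℝ)) * ∑ k ∈ range n, (w n k 0 ^ 2 + w n k 1 ^ 2))
      atTop (𝓝 σ2)) :
    Tendsto (fun n : ℕ => ∏ k ∈ range n,
        (Real.cos (Real.sqrt (2 / n) * w n k 0) + Real.cos (Real.sqrt (2 / n) * w n k 1)) / 2)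
      atTop (𝓝 (Real.exp (-(σ2 / 2)))) := by
  set x : ℕ → ℕ → ℝ := fun n k =>
    1 - (Real.cos (Real.sqrt (2 / n) * w n k 0) + Real.cos (Real.sqrt (2 / n) * w n k 1)) / 2 with hx
  have hprod : ∀ n, ∏ k ∈ range n,
      (Real.cos (Real.sqrt (2 / n) * w n k 0) + Real.cos (Real.sqrt (2 / n) * w n k 1)) / 2 =
      ∏ k ∈ range n, (1 - x n k) := fun n => Finset.prod_congr rfl fun k _ => by simp [hx]
  simp_rw [hprod]
  -- basic bounds on the rescaled coefficients `a = √(2/n) w`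
  have ha2 : ∀ (n : ℕ) (k : ℕ) (j : Fin 2),
      (Real.sqrt (2 / (n : ℝ)) * w n k j) ^ 2 = 2 / (n : ℝ) * w n k j ^ 2 := fun n k j => by
    rw [mul_pow, Real.sq_sqrt (by positivity)]
  have hw2 : ∀ (n : ℕ) (k : ℕ) (j : Fin 2), w n k j ^ 2 ≤ M ^ 2 := fun n k j => by
    have := hM n k j; rw [← sq_abs]; exact pow_le_pow_left₀ (abs_nonneg _) this 2
  -- eventually `n ≥ 2 M² + 1`, so that `|a| ≤ 1` and `x ≤ 1/2`
  have hev : ∀ᶠ n : ℕ in atTop, 2 * M ^ 2 + 1 ≤ (n : ℝ) := by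
    obtain ⟨N, hN⟩ := exists_nat_ge (2 * M ^ 2 + 1)
    filter_upwards [eventually_ge_atTop N] with n hn
    exact hN.trans (by exact_mod_cast hn)
  have key : ∀ n : ℕ, 2 * M ^ 2 + 1 ≤ (n : ℝ) → ∀ k, ∀ j,
      |Real.sqrt (2 / n) * w n k j| ≤ 1 ∧ 2 / (n : ℝ) * w n k j ^ 2 ≤ M ^ 2 * (2 / n) ∧
        M ^ 2 * (2 / (n : ℝ)) ≤ 1 := by
    intro n hn k j
    have hn0 : (0 : ℝ) < n := by nlinarith [sq_nonneg M]
    have h3 : M ^ 2 * (2 / (n : ℝ)) ≤ 1 := by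
      rw [mul_div_assoc', div_le_one hn0]; linarith
    have h2 : 2 / (n : ℝ) * w n k j ^ 2 ≤ M ^ 2 * (2 / n) := by
      rw [mul_comm]; exact mul_le_mul_of_nonneg_right (hw2 n k j) (by positivity)
    refine ⟨?_, h2, h3⟩
    rw [← sq_le_one_iff_abs_le_one, ha2]
    exact h2.trans h3
  refine tendsto_prod_one_sub ?_ ?_ ?_
  · filter_upwards [hev] with n hn k _
    refine ⟨one_sub_half_cos_add_cos_nonneg _ _, (one_sub_half_cos_add_cos_le _ _).trans ?_⟩
    have h0 := (key n hn k 0).2; have h1 := (key n hn k 1).2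
    rw [ha2, ha2]; linarith [h0.1, h1.1, h0.2]
  · -- `Σ x = (1/(2n)) Σ |w|² + Σ ρ`, `Σ |ρ| ≤ (5/96) · 4 M⁴/n`
    have hmain : Tendsto (fun n : ℕ => ∑ k ∈ range n,
        ((Real.sqrt (2 / n) * w n k 0) ^ 2 + (Real.sqrt (2 / n) * w n k 1) ^ 2) / 4)
        atTop (𝓝 (σ2 / 2)) := by
      have : (fun n : ℕ => ∑ k ∈ range n,
          ((Real.sqrt (2 / n) * w n k 0) ^ 2 + (Real.sqrt (2 / n) * w n k 1) ^ 2) / 4) =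
          fun n : ℕ => (1 / 2) * ((1 / (n : ℝ)) * ∑ k ∈ range n, (w n k 0 ^ 2 + w n k 1 ^ 2)) := by
        funext n
        simp_rw [ha2]
        rw [Finset.mul_sum, Finset.mul_sum]
        refine Finset.sum_congr rfl fun k _ => ?_
        ring
      rw [this, show σ2 / 2 = (1 / 2) * σ2 by ring]
      exact hlim.const_mul _
    have herr : Tendsto (fun n : ℕ => ∑ k ∈ range n, (x n k -
        ((Real.sqrt (2 / n) * w n k 0) ^ 2 + (Real.sqrt (2 / n) * w n k 1) ^ 2) / 4))
        atTop (𝓝 0) := by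
      rw [tendsto_zero_iff_abs_tendsto_zero]
      have hbd : Tendsto (fun n : ℕ => 5 / 96 * (M ^ 4 * 4) * (1 / (n : ℝ))) atTop (𝓝 0) := by
        have := tendsto_one_div_atTop_nhds_zero_nat.const_mul (5 / 96 * (M ^ 4 * 4))
        rwa [mul_zero] at this
      refine squeeze_zero' (Eventually.of_forall fun n => abs_nonneg _) ?_ hbd
      filter_upwards [hev, eventually_gt_atTop 0] with n hn hn0
      simp only [Function.comp_apply]
      refine (Finset.abs_sum_le_sum_abs _ _).trans ?_
      have hterm : ∀ k ∈ range n, |x n k -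
          ((Real.sqrt (2 / n) * w n k 0) ^ 2 + (Real.sqrt (2 / n) * w n k 1) ^ 2) / 4| ≤
          5 / 96 * (M ^ 4 * 4) * (1 / (n : ℝ)) ^ 2 := by
        intro k _
        refine (half_cos_add_cos_bound (key n hn k 0).1 (key n hn k 1).1).trans ?_
        have q0 : (Real.sqrt (2 / n) * w n k 0) ^ 4 ≤ (M ^ 2 * (2 / n)) ^ 2 := by
          rw [show (4 : ℕ) = 2 * 2 from rfl, pow_mul, ha2]
          exact pow_le_pow_left₀ (by positivity) (key n hn k 0).2.1 2
        have q1 : (Real.sqrt (2 / n) * w n k 1) ^ 4 ≤ (M ^ 2 * (2 / n)) ^ 2 := by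
          rw [show (4 : ℕ) = 2 * 2 from rfl, pow_mul, ha2]
          exact pow_le_pow_left₀ (by positivity) (key n hn k 1).2.1 2
        have : (M ^ 2 * (2 / (n : ℝ))) ^ 2 = M ^ 4 * 4 * (1 / n) ^ 2 := by ring
        rw [this] at q0 q1
        nlinarith
      refine (Finset.sum_le_sum hterm).trans ?_
      rw [Finset.sum_const, Finset.card_range, nsmul_eq_mul]
      have hn' : (0 : ℝ) < n := by exact_mod_cast hn0
      field_simp
      nlinarith [sq_nonneg M]
    have := herr.add hmain
    simp only [zero_add] at this
    refine this.congr fun n => ?_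
    rw [← Finset.sum_add_distrib]
    exact Finset.sum_congr rfl fun k _ => by ring
  · -- `Σ x² ≤ n (M²/n)² → 0`
    rw [tendsto_zero_iff_abs_tendsto_zero]
    have hbd : Tendsto (fun n : ℕ => M ^ 4 * (1 / (n : ℝ))) atTop (𝓝 0) := by
      have := tendsto_one_div_atTop_nhds_zero_nat.const_mul (M ^ 4)
      rwa [mul_zero] at this
    refine squeeze_zero' (Eventually.of_forall fun n => abs_nonneg _) ?_ hbd
    filter_upwards [hev, eventually_gt_atTop 0] with n hn hn0
    simp only [Function.comp_apply]
    rw [abs_of_nonneg (Finset.sum_nonneg fun k _ => sq_nonneg _)]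
    have hterm : ∀ k ∈ range n, x n k ^ 2 ≤ (M ^ 2 * (1 / (n : ℝ))) ^ 2 := by
      intro k _
      have hx0 : 0 ≤ x n k := one_sub_half_cos_add_cos_nonneg _ _
      have hx1 : x n k ≤ M ^ 2 * (1 / (n : ℝ)) := by
        refine (one_sub_half_cos_add_cos_le _ _).trans ?_
        rw [ha2, ha2]
        have h0 := (key n hn k 0).2.1; have h1 := (key n hn k 1).2.1
        have : M ^ 2 * (2 / (n : ℝ)) = 2 * (M ^ 2 * (1 / n)) := by ring
        rw [this] at h0 h1
        linarith
      exact pow_le_pow_left₀ hx0 hx1 2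
    refine (Finset.sum_le_sum hterm).trans ?_
    rw [Finset.sum_const, Finset.card_range, nsmul_eq_mul]
    have hn' : (0 : ℝ) < n := by exact_mod_cast hn0
    field_simp
    nlinarith [sq_nonneg M, pow_pos hn' 2]

/-! ### The Riemann sum of the squared step coefficients -/

/-- `#{k < n : k < c} = min c n`. [folklore] -/
theorem sum_range_ite_lt (n c : ℕ) :
    ∑ k ∈ range n, (if k < c then (1 : ℝ) else 0) = ((min c n : ℕ) : ℝ) := by
  rw [Finset.sum_boole]
  congr 1
  have : (range n).filter (fun k => k < c) = range (min c n) := by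
    ext k; simp [Finset.mem_filter, Finset.mem_range, and_comm]
  rw [this, Finset.card_range]

/-- **The squared step coefficients sum to the covariance Riemann sum**: for dual vectors `v_i`
and times `0 ≤ t_i ≤ 1`, with `w_{n,k} = Σ_{i : k < ⌊n t_i⌋} v_i`,
`Σ_{k<n} |w_{n,k}|² = Σ_{i,i'} (v_i · v_{i'}) ⌊n min(t_i, t_{i'})⌋` exactly. [folklore] -/
theorem sum_sq_coeff_eq {ι : Type*} (s : Finset ι) (v : ι → Fin 2 → ℝ) (t : ι → ℝ)
    (ht : ∀ i ∈ s, 0 ≤ t i ∧ t i ≤ 1) (n : ℕ) :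
    ∑ k ∈ range n, ∑ j : Fin 2, (∑ i ∈ s with k < ⌊(n : ℝ) * t i⌋₊, v i j) ^ 2 =
      ∑ i ∈ s, ∑ i' ∈ s, (∑ j : Fin 2, v i j * v i' j) * ((⌊(n : ℝ) * min (t i) (t i')⌋₊ : ℕ) : ℝ) := by
  classical
  set m : ι → ℕ := fun i => ⌊(n : ℝ) * t i⌋₊ with hm
  set G : ι → ι → Fin 2 → ℕ → ℝ := fun i i' j k =>
    (if k < m i ∧ k < m i' then (1 : ℝ) else 0) * (v i j * v i' j) with hG
  -- expand the square of the filtered sum into a double sum with indicators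
  have hexp : ∀ (k : ℕ) (j : Fin 2), (∑ i ∈ s with k < m i, v i j) ^ 2 = ∑ i ∈ s, ∑ i' ∈ s, G i i' j k := by
    intro k j
    rw [Finset.sum_filter, sq, Finset.sum_mul_sum]
    refine Finset.sum_congr rfl fun i _ => Finset.sum_congr rfl fun i' _ => ?_
    simp only [hG]
    by_cases h1 : k < m i <;> by_cases h2 : k < m i' <;> simp [h1, h2]
  -- the count of `k`
  have hcount : ∀ i ∈ s, ∀ i' ∈ s, ∑ k ∈ range n, (if k < m i ∧ k < m i' then (1 : ℝ) else 0) =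
      ((⌊(n : ℝ) * min (t i) (t i')⌋₊ : ℕ) : ℝ) := by
    intro i hi i' hi'
    have hmin : ∀ k : ℕ, (k < m i ∧ k < m i') ↔ k < ⌊(n : ℝ) * min (t i) (t i')⌋₊ := by
      intro k
      rw [mul_min_of_nonneg _ _ (Nat.cast_nonneg n), Nat.floor_mono.map_min, lt_min_iff]
    simp_rw [hmin]
    rw [sum_range_ite_lt]
    congr 1
    refine min_eq_left (Nat.floor_le_of_le ?_)
    have := (ht i hi).2; have := (ht i' hi').2
    nlinarith [min_le_left (t i) (t i'), (Nat.cast_nonneg n : (0:ℝ) ≤ n)]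
  calc ∑ k ∈ range n, ∑ j : Fin 2, (∑ i ∈ s with k < m i, v i j) ^ 2
      = ∑ k ∈ range n, ∑ j : Fin 2, ∑ i ∈ s, ∑ i' ∈ s, G i i' j k := by simp_rw [hexp]
    _ = ∑ j : Fin 2, ∑ k ∈ range n, ∑ i ∈ s, ∑ i' ∈ s, G i i' j k := Finset.sum_comm
    _ = ∑ j : Fin 2, ∑ i ∈ s, ∑ k ∈ range n, ∑ i' ∈ s, G i i' j k :=
        Finset.sum_congr rfl fun j _ => Finset.sum_comm
    _ = ∑ j : Fin 2, ∑ i ∈ s, ∑ i' ∈ s, ∑ k ∈ range n, G i i' j k :=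
        Finset.sum_congr rfl fun j _ => Finset.sum_congr rfl fun i _ => Finset.sum_comm
    _ = ∑ i ∈ s, ∑ j : Fin 2, ∑ i' ∈ s, ∑ k ∈ range n, G i i' j k := Finset.sum_comm
    _ = ∑ i ∈ s, ∑ i' ∈ s, ∑ j : Fin 2, ∑ k ∈ range n, G i i' j k :=
        Finset.sum_congr rfl fun i _ => Finset.sum_comm
    _ = ∑ i ∈ s, ∑ i' ∈ s, (∑ j : Fin 2, v i j * v i' j) * ((⌊(n : ℝ) * min (t i) (t i')⌋₊ : ℕ) : ℝ) := by
        refine Finset.sum_congr rfl fun i hi => Finset.sum_congr rfl fun i' hi' => ?_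
        rw [Finset.sum_mul]
        refine Finset.sum_congr rfl fun j _ => ?_
        simp only [hG]
        rw [← Finset.sum_mul, hcount i hi i' hi']
        ring

/-- **The covariance Riemann sum converges**: `(1/n) Σ_{k<n} |w_{n,k}|² → σ²` with
`σ² = Σ_{i,i'} (v_i · v_{i'}) min(t_i, t_{i'})` — the variance of `Σ_i v_i · W(t_i)` for a
standard planar Brownian motion `W`. [folklore] -/
theorem tendsto_sum_sq_coeff {ι : Type*} (s : Finset ι) (v : ι → Fin 2 → ℝ) (t : ι → ℝ)
    (ht : ∀ i ∈ s, 0 ≤ t i ∧ t i ≤ 1) :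
    Tendsto (fun n : ℕ => (1 / (n : ℝ)) * ∑ k ∈ range n,
        ((∑ i ∈ s with k < ⌊(n : ℝ) * t i⌋₊, v i 0) ^ 2 +
          (∑ i ∈ s with k < ⌊(n : ℝ) * t i⌋₊, v i 1) ^ 2)) atTop
      (𝓝 (∑ i ∈ s, ∑ i' ∈ s, (∑ j : Fin 2, v i j * v i' j) * min (t i) (t i'))) := by
  have h : ∀ n : ℕ, (1 / (n : ℝ)) * ∑ k ∈ range n,
      ((∑ i ∈ s with k < ⌊(n : ℝ) * t i⌋₊, v i 0) ^ 2 +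
        (∑ i ∈ s with k < ⌊(n : ℝ) * t i⌋₊, v i 1) ^ 2) =
      ∑ i ∈ s, ∑ i' ∈ s, (∑ j : Fin 2, v i j * v i' j) *
        (((⌊(n : ℝ) * min (t i) (t i')⌋₊ : ℕ) : ℝ) / n) := by
    intro n
    have := sum_sq_coeff_eq s v t ht n
    simp only [Fin.sum_univ_two] at this ⊢
    rw [this, Finset.mul_sum]
    refine Finset.sum_congr rfl fun i _ => ?_
    rw [Finset.mul_sum]
    refine Finset.sum_congr rfl fun i' _ => ?_
    ring
  simp_rw [h]
  refine tendsto_finsetSum _ fun i hi => tendsto_finsetSum _ fun i' hi' => ?_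
  exact (tendsto_floor_mul_div (le_min (ht i hi).1 (ht i' hi').1)).const_mul _

/-- **Characteristic function of the grid values of the rescaled walk converges to the Gaussian
one**: for dual vectors `v_i ∈ ℝ²` and times `t_i ∈ [0,1]`,
`𝔼 exp(i √(2/n) Σ_i v_i · ω(⌊n t_i⌋)) → exp(-σ²/2)`, `σ² = Σ_{i,i'} (v_i·v_{i'}) min(t_i,t_{i'})`
(= `E exp(i Σ_i v_i · W(t_i))` for standard planar Brownian motion). The random-walk half of the
convergence of the finite-dimensional distributions. [cite: Billingsley1999, proof of Theorem 8.2] -/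
theorem tendsto_expect_exp_scaled_pos {ι : Type*} (s : Finset ι) (v : ι → Fin 2 → ℝ) (t : ι → ℝ)
    (ht : ∀ i ∈ s, 0 ≤ t i ∧ t i ≤ 1) :
    Tendsto (fun n : ℕ => 𝔼 ω : StepSeq n, Complex.exp (Complex.I *
        ((∑ i ∈ s, ∑ j, (Real.sqrt (2 / n) * v i j) * (pos ω ⌊(n : ℝ) * t i⌋₊ j : ℝ) : ℝ) : ℂ)))
      atTop (𝓝 ((Real.exp (-((∑ i ∈ s, ∑ i' ∈ s,
        (∑ j : Fin 2, v i j * v i' j) * min (t i) (t i')) / 2)) : ℝ) : ℂ)) := by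
  -- the exact product formula
  have hformula : ∀ n : ℕ, 𝔼 ω : StepSeq n, Complex.exp (Complex.I *
      ((∑ i ∈ s, ∑ j, (Real.sqrt (2 / n) * v i j) * (pos ω ⌊(n : ℝ) * t i⌋₊ j : ℝ) : ℝ) : ℂ)) =
      ((∏ k ∈ range n, (Real.cos (Real.sqrt (2 / n) * ∑ i ∈ s with k < ⌊(n : ℝ) * t i⌋₊, v i 0) +
        Real.cos (Real.sqrt (2 / n) * ∑ i ∈ s with k < ⌊(n : ℝ) * t i⌋₊, v i 1)) / 2 : ℝ) : ℂ) := by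
    intro n
    rw [expect_exp_sum_pos s (fun i j => Real.sqrt (2 / n) * v i j) (fun i => ⌊(n : ℝ) * t i⌋₊)]
    push_cast
    rw [← Fin.prod_univ_eq_prod_range]
    refine Finset.prod_congr rfl fun k _ => ?_
    rw [← Finset.mul_sum, ← Finset.mul_sum]
  simp_rw [hformula]
  refine (Complex.continuous_ofReal.tendsto _).comp ?_
  refine tendsto_prod_half_cos_add_cos (w := fun n k j => ∑ i ∈ s with k < ⌊(n : ℝ) * t i⌋₊, v i j)
    (M := ∑ i ∈ s, (|v i 0| + |v i 1|)) (fun n k j => ?_) (tendsto_sum_sq_coeff s v t ht)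
  refine (Finset.abs_sum_le_sum_abs _ _).trans ?_
  refine (Finset.sum_le_sum_of_subset_of_nonneg (Finset.filter_subset _ s)
    (fun i _ _ => abs_nonneg _)).trans (Finset.sum_le_sum fun i _ => ?_)
  fin_cases j <;> simp [le_add_iff_nonneg_right, le_add_iff_nonneg_left]

end Edwards2D

end Literature.Barriers.CriticalPhenomena

end
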